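import Mathlib

/-! # `Balaban1983to89.B9SectCRefine` — B9 Sect. C, pp. 411/412/415: the REFINEMENT 𝒟 → 𝒟′ (→ 𝒟″) of the
partition of unity {h_□} and the two printed claims «it is possible only if □′ = □₀», «h′_{□₀} = 1 on □̃», kernel-checked

CITATION HEADER (lean-in-tree rule 2026-08-18).  Paper sub-cell `b2b-balaban-b09` (gen 9, journal claim
`B9-SECTC-REFINE`, cell pub-balaban) on T. Bałaban, *Propagators for lattice gauge theories in a background field*,
Commun. Math. Phys. **99** (1985) 389–434 [`Balaban1985BackgroundPropagators`] (= B9; journal page = PDF page + 388),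
pp. 411, 412, 415 [PDF 23, 24, 27] (renders `b2b-balaban-ref1/pages/1985-cmp99-background-propagators/…-p023-x2.png`,
`…-p024-x2.png`, `…-p027-x2.png`, READ AS IMAGES by this unit), with [3] of B9's companion series = *Propagators and
renormalization transformations for lattice gauge theories. I*, Commun. Math. Phys. **95** (1984) 17–40
[`Balaban1984PropagatorsI`] (= B5) p. 36 [PDF 20], display (1.118) (render `…/1984-cmp95-propagators-rt-I/…-p020-x2.png`,
read as an image).  Sibling of `…Balaban1983to89.B9SectCCubes` (the sup-norm cube calculus □, □̃ⁿ, □₀ = □̃², 5^d;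
NOT imported — see SCOPE); imports Mathlib only; nothing landed is edited.

WHAT IS PRINTED (verbatim).
* B5 p. 36: *"We consider the lattice of cubes of size M₀, M₀ = L^{m₀}, defined by the lattice T^{(k+m₀)}_{M₀}, and
  cubes □_z of size 2M₀ and with a center at the point z ∈ T^{(k+m₀)}_{M₀}. These cubes cover the lattice T_η. We
  construct a partition of unity taking the functions h_z(x) = Π_{μ=1}^d h((x_μ − z_μ)/M₀), h ∈ C₀^∞(]−2/3, 2/3[),
  h(t) = 1 for t ∈ [−1/3, 1/3], h is chosen in such a way that Σ_n h²(t − n) = 1, hence Σ_z h_z²(x) = 1. (1.118)"*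
* B9 p. 411: *"Let us assume that □ ∈ 𝒟_j. If □̃ does not intersect any cube of the family 𝒟_{j+1}, then we define 𝒟′
  replacing in 𝒟 the cube □ by □̃², and removing all the cubes intersecting □̃. If □̃ intersects a cube from 𝒟_{j+1},
  then we take a cube □₁ from 𝒟_{j+1} which is closest to the center of □, we replace □ by □̃₁², and we remove all
  the cubes which intersect □̃₁. Let us denote by □₀ the cube □̃² in the first case, and □̃₁² in the second. The
  partition 𝒟′ coincides with 𝒟 outside □₀. We construct the corresponding partition of unity {h′_□}_{□∈𝒟′}, and the
  random walk expansion (3.90) for the partition 𝒟′."* … *"The characteristic function 1 − □̃ at the beginning of the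
  term, and the function h_□ at the end, restrict a kernel of the term to points separated at least by a distance
  ML^jη (if □ ∈ 𝒟_j)."*
* B9 p. 412: *"We have to consider yet the case when we have only operators h′_{□′}G_{□′}h′_{□′} in the term. Because of
  the restrictions introduced by the functions □̃, h_□, it is possible only if □′ = □₀ for both operators. Thus we
  have the term □̃Q′h′_{□₀}G′_{□₀}h′²_{□₀}G′_{□₀}h′_{□₀}Q′h_□C_□h_□. Let us notice that by the construction of the partition
  𝒟′ we have h′_{□₀} = 1 on □̃, hence we have only the function h′²_{□₀} in the above expression."*
* B9 p. 415: *"For the cube □₀ we construct a new partition 𝒟″ replacing □₀ by □̃₀² and removing from 𝒟′ all the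
  cubes which intersect □̃₀."* … *"In terms of the original cubes □, or □₁, we have □̃₀² = □̃⁴, or □̃₀² = □̃₁⁴"*.

THE MODEL.  Print constructs {h′_□}_{□∈𝒟′} without a formula.  Since 𝒟′ keeps every cube of 𝒟 off □₀ unchanged
(*"coincides with 𝒟 outside □₀"*), the natural refinement keeps h′_□ = h_□ there and MERGES the weights of the
removed family R into the new cube: **h′_{□₀} := √(Σ_{□′∈R} h²_{□′})** (`merged`; the refined family `refine h R` is
indexed by `Option ι`, `none` = □₀, a removed index carrying the weight 0).  `refine_unique`: this is the ONLY
non-negative choice with Σ_{𝒟′} h′² = Σ_𝒟 h² that keeps the untouched h_□ — so the model is canonical, but it is a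
model (cell DIVERGENCE row): any other admissible {h′} differs from it only in the signs of h′_{□₀}.  The support
datum is (1.118): h_{□′} vanishes off the OPEN cube of half-width M about its centre (print: off the (2/3)M-cube;
in B9's Sect. C the role of M₀ is played by the big-block size M, cubes □ = 2^d big blocks, B9 p. 408), written
here as an abstract hypothesis `hsupp : h i x ≠ 0 → x ∈ cube i` (§3) and in coordinates (§4).

WHAT THIS FILE CERTIFIES (kernel, zero sorry, Mathlib only; every item [folklore] real analysis / arithmetic —
no operator, estimate or configuration of B9 occurs).
1. §1 `merged`: `merged_sq` (h′²_{□₀} = Σ_R h²), `merged_nonneg`, `merged_le_one` and `merged_eq_one_of_vanish`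
   under Σ_𝒟 h² = 1 (`hpu`, (1.118)/(2.36)), `merged_eq_zero_iff`, and the ℓ²-LIPSCHITZ TRANSFER
   `abs_merged_sub_le`: |h′_{□₀}(x) − h′_{□₀}(x′)| ≤ √(Σ_{□′∈R}(h_{□′}(x) − h_{□′}(x′))²) (reverse Minkowski via the
   Cauchy–Schwarz inequality `Finset.sum_mul_sq_le_sq_mul_sq`), `abs_merged_sub_le_of_forall`: ≤ √#R·δ when every
   |h_{□′}(x) − h_{□′}(x′)| ≤ δ — so the slow variation ℓ₀, ℓ₁ = O(M⁻¹) of the h_□ that the cell's `…B9Eq395Small` /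
   `…B9Eq395Hom` take as hypotheses for h′_{□₀} survives the merge with the factor √(5^d) (#R = 5^d, `B9SectCCubes.card_shifts`).
2. §2 `refine`: `sum_refine_sq` (Σ_{𝒟′} h′² = Σ_𝒟 h² pointwise, any finite index type, any point type),
   `refine_pu` (Σ_{𝒟′} h′² = 1 from Σ_𝒟 h² = 1 — the partition-of-unity identity the random walk expansion (3.90)
   for 𝒟′ needs), `abs_refine_le_one`, `refine_unique`, and `merged_refine`: refining `refine h R` again over a
   disjoint family R′ (plus □₀ itself) is merging h over R ∪ R′ — p. 415's 𝒟″ in terms of the original cubes.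
3. §3 ABSTRACT LOCALITY (both cases of p. 411 at once): cubes `cube : ι → Set X`, `hsupp`, a protected set T (□̃ in
   case 1; in case 2 any T with T ⊆ □̃₁ works the same way) and the removal rule `hR`: every cube MEETING T is
   removed.  Then `vanish_on_protected` / `refine_some_vanish` (every kept h′_{□′}, □′ ≠ □₀, vanishes on T — p. 412
   *"it is possible only if □′ = □₀"*), `merged_eq_one_on_protected` (h′_{□₀} = 1 on T — p. 412 *"by the construction
   of the partition 𝒟′ we have h′_{□₀} = 1 on □̃"*), `exists_mem_cube_of_merged_ne_zero` (supp h′_{□₀} ⊂ ⋃_R □′ = □₀).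
4. §4 COORDINATES (case 1 of p. 411 and 𝒟″ of p. 415; lengths in units L^jη, points `x : Fin d → ℝ`, the cubes of
   𝒟_j centred at c + Mk, k ∈ ℤ^d, as in `B9SectCCubes`): `int_abs_le_of_lt` — a point of {|x − c|_∞ ≤ nM} inside the
   open cube about c + Mk forces |k|_∞ ≤ n; hence with R ⊇ {□′ : |k|_∞ ≤ n}: `merged_eq_one_on_box` (h′ = 1 on
   {|x − c|_∞ ≤ nM}), `vanish_on_box`, and with R = {|k|_∞ ≤ n} exactly: `merged_support_box` (h′ ≠ 0 ⇒ |x − c|_∞ <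
   (n+1)M).  Instances: n = 2 (`p412_hprime_eq_one`, `p412_kept_vanish`, `p411_hprime_support`: 𝒟′, R = the 5^d cubes
   |k|_∞ ≤ 2 of `B9SectCCubes.shifts`, h′_{□₀} = 1 on □̃ = {|x − c|_∞ ≤ 2M} = `B9SectCCubes.tilde c M 1`, supp h′_{□₀}
   inside □₀ = □̃² = {|x − c|_∞ ≤ 3M}) and n = 4 (`p415_hsecond_eq_one`, `p415_hsecond_support`: 𝒟″, the 9^d cubes
   |k|_∞ ≤ 4, h″ = 1 on □̃₀ = □̃³, supported inside □̃₀² = □̃⁴).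
5. §6 THE (1.118) PRODUCT CLASS: `sqrt_prod_eq` ([folklore] √Π = Π√), `merged_pi` — for product weights
   h_k(x) = Π_μ g_μ(k_μ, x) over a product family R = S^d the merged weight FACTORISES, h′_{□₀} = Π_μ (1-D merge of
   g_μ over S) (`Finset.prod_univ_sum`), and `merged_eq_abs_of_single` — where exactly one merged weight is alive the
   merge is its absolute value.  Print-level consequence (not itself formalised): for the printed profiles (h ≥ 0,
   centres spaced M₀, supp h inside the (2/3)M₀-cube, so at most two consecutive 1-D profiles are alive at a point)
   the 1-D merge over |n| ≤ 2 equals 1 for |t| ≤ (7/3)M₀ and coincides with h(t ∓ 2M₀) for ±t ≥ (5/3)M₀ — three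
   smooth descriptions agreeing on overlapping open intervals — hence h′_{□₀} is C^∞ with the derivative bounds of
   (1.118) itself: the smoothness of the model needed for K(h′_{□₀}) in (3.90) reduces to (1.118).
SCOPE (candid).  `B9SectCCubes` (p182936) is not imported only because the farm's check nodes had not yet built it
when this file was checked; every set here is written in coordinates and equals the corresponding `box`/`tilde` by
`rfl` ({x | ∀ j, |x j − c j| ≤ r} = `box c r`, `tilde c M n = box c ((n+1)M)`).  The lattice (the h_□ live on lattice
points — any point type `X` is allowed, in §4 the continuum envelope ℝ^d ⊃ lattice), the sets B^j(Λ_j), the choice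
of □₁ in case 2, smoothness classes (beyond the reduction of item 5) and the operators of (3.90)/(3.95) are NOT
modelled.  Value = kernel-checked
bookkeeping for two print sentences the cell's Sect. C modules use as hypotheses (`…B9Eq395Small.regroup_412`'s
`h1`/`h2` via `chi_comp_mulOp_eq_of_local (hh' : … → h' x = 1)`, `…B9Eq319Avg` p. 412 note), NOT summit progress.
-/

namespace Literature.MathematicalPhysics.QuantumFieldTheory.Balaban1983to89.B9SectCRefine

open Finset

variable {ι X : Type*}

/-! ## §1  The merged weight h′_{□₀} = √(Σ_{□′∈R} h²_{□′}) -/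

/-- **h′_{□₀}** — the weight of the new cube □₀ of 𝒟′: the ℓ²-merge of the weights of the removed family `R`.
[cite: Balaban1985BackgroundPropagators, p.411 (𝒟′, {h′_□}); model] -/
noncomputable def merged (h : ι → X → ℝ) (R : Finset ι) (x : X) : ℝ := Real.sqrt (∑ i ∈ R, h i x ^ 2)

/-- Σ_R h² ≥ 0. [folklore] -/
theorem sum_sq_nonneg (h : ι → X → ℝ) (R : Finset ι) (x : X) : 0 ≤ ∑ i ∈ R, h i x ^ 2 :=
  Finset.sum_nonneg fun _ _ => sq_nonneg _

/-- h′_{□₀} ≥ 0. [folklore] -/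
theorem merged_nonneg (h : ι → X → ℝ) (R : Finset ι) (x : X) : 0 ≤ merged h R x := Real.sqrt_nonneg _

/-- h′²_{□₀} = Σ_{□′∈R} h²_{□′}. [folklore] -/
theorem merged_sq (h : ι → X → ℝ) (R : Finset ι) (x : X) : merged h R x ^ 2 = ∑ i ∈ R, h i x ^ 2 :=
  Real.sq_sqrt (sum_sq_nonneg h R x)

/-- h′_{□₀}(x) = 1 iff Σ_R h²(x) = 1. [folklore] -/
theorem merged_eq_one_iff (h : ι → X → ℝ) (R : Finset ι) (x : X) :
    merged h R x = 1 ↔ ∑ i ∈ R, h i x ^ 2 = 1 := by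
  unfold merged
  constructor
  · intro h1
    have := Real.sq_sqrt (sum_sq_nonneg h R x)
    rw [h1, one_pow] at this
    exact this.symm
  · intro h1
    rw [h1, Real.sqrt_one]

/-- h′_{□₀}(x) = 0 iff every merged weight vanishes at x. [folklore] -/
theorem merged_eq_zero_iff (h : ι → X → ℝ) (R : Finset ι) (x : X) :
    merged h R x = 0 ↔ ∀ i ∈ R, h i x = 0 := by
  unfold merged
  rw [Real.sqrt_eq_zero (sum_sq_nonneg h R x),
    Finset.sum_eq_zero_iff_of_nonneg (fun i _ => sq_nonneg (h i x))]
  exact forall₂_congr fun _ _ => pow_eq_zero_iff two_ne_zero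

/-- Where h′_{□₀} ≠ 0 some merged weight is ≠ 0. [folklore] -/
theorem exists_ne_zero_of_merged_ne_zero (h : ι → X → ℝ) (R : Finset ι) {x : X} (hx : merged h R x ≠ 0) :
    ∃ i ∈ R, h i x ≠ 0 := by
  by_contra hno
  exact hx ((merged_eq_zero_iff h R x).mpr fun i hi => not_ne_iff.mp fun hne => hno ⟨i, hi, hne⟩)

/-- Splitting the full square sum at `R`: Σ_𝒟 h² = h′²_{□₀} + Σ_{𝒟∖R} h². [folklore] -/
theorem sum_sq_eq_merged_sq_add [Fintype ι] [DecidableEq ι] (h : ι → X → ℝ) (R : Finset ι) (x : X) :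
    ∑ i, h i x ^ 2 = merged h R x ^ 2 + ∑ i ∈ Rᶜ, h i x ^ 2 := by
  rw [merged_sq, Finset.sum_add_sum_compl]

/-- 0 ≤ h′_{□₀} ≤ 1 under the partition-of-unity identity Σ_𝒟 h² = 1 ((1.118) / [4] (2.36)). [folklore] -/
theorem merged_le_one [Fintype ι] [DecidableEq ι] (h : ι → X → ℝ) (R : Finset ι) {x : X}
    (hpu : ∑ i, h i x ^ 2 = 1) : merged h R x ≤ 1 := by
  have h1 : merged h R x ^ 2 ≤ 1 := by
    rw [← hpu, sum_sq_eq_merged_sq_add h R x]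
    exact le_add_of_nonneg_right (Finset.sum_nonneg fun _ _ => sq_nonneg _)
  nlinarith [merged_nonneg h R x]

/-- **h′_{□₀}(x) = 1 as soon as every weight NOT merged vanishes at x** (under Σ_𝒟 h² = 1) — the abstract form of
p. 412's *"h′_{□₀} = 1 on □̃"*. [folklore] -/
theorem merged_eq_one_of_vanish [Fintype ι] (h : ι → X → ℝ) (R : Finset ι) {x : X}
    (hpu : ∑ i, h i x ^ 2 = 1) (hvan : ∀ i, i ∉ R → h i x = 0) : merged h R x = 1 := by
  rw [merged_eq_one_iff, ← hpu]
  exact Finset.sum_subset (Finset.subset_univ R) fun i _ hi => by rw [hvan i hi]; ring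

/-- **ℓ²-Lipschitz transfer**: |h′_{□₀}(x) − h′_{□₀}(x′)| ≤ √(Σ_{□′∈R}(h_{□′}(x) − h_{□′}(x′))²) (reverse Minkowski in
ℓ²(R), via Cauchy–Schwarz). [folklore] -/
theorem abs_merged_sub_le (h : ι → X → ℝ) (R : Finset ι) (x x' : X) :
    |merged h R x - merged h R x'| ≤ Real.sqrt (∑ i ∈ R, (h i x - h i x') ^ 2) := by
  apply Real.abs_le_sqrt
  have hA := sum_sq_nonneg h R x
  have hB := sum_sq_nonneg h R x'
  have hC : ∑ i ∈ R, (h i x - h i x') ^ 2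
      = ∑ i ∈ R, h i x ^ 2 + ∑ i ∈ R, h i x' ^ 2 - 2 * ∑ i ∈ R, h i x * h i x' := by
    rw [Finset.mul_sum, ← Finset.sum_add_distrib, ← Finset.sum_sub_distrib]
    exact Finset.sum_congr rfl fun i _ => by ring
  have hP : ∑ i ∈ R, h i x * h i x' ≤ merged h R x * merged h R x' := by
    calc ∑ i ∈ R, h i x * h i x' ≤ |∑ i ∈ R, h i x * h i x'| := le_abs_self _
      _ = Real.sqrt ((∑ i ∈ R, h i x * h i x') ^ 2) := (Real.sqrt_sq_eq_abs _).symm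
      _ ≤ Real.sqrt ((∑ i ∈ R, h i x ^ 2) * ∑ i ∈ R, h i x' ^ 2) :=
          Real.sqrt_le_sqrt (Finset.sum_mul_sq_le_sq_mul_sq R (fun i => h i x) fun i => h i x')
      _ = merged h R x * merged h R x' := Real.sqrt_mul hA _
  rw [hC, sub_sq, merged_sq, merged_sq]
  linarith

/-- Uniform version: if every merged weight moves by at most δ between x and x′, then h′_{□₀} moves by at most
√#R · δ (#R = 5^d for 𝒟′, `B9SectCCubes.card_shifts`). [folklore] -/
theorem abs_merged_sub_le_of_forall (h : ι → X → ℝ) (R : Finset ι) (x x' : X) {δ : ℝ} (hδ : 0 ≤ δ)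
    (hle : ∀ i ∈ R, |h i x - h i x'| ≤ δ) :
    |merged h R x - merged h R x'| ≤ Real.sqrt R.card * δ := by
  refine (abs_merged_sub_le h R x x').trans ?_
  have h1 : ∑ i ∈ R, (h i x - h i x') ^ 2 ≤ R.card * δ ^ 2 := by
    calc ∑ i ∈ R, (h i x - h i x') ^ 2 ≤ ∑ i ∈ R, δ ^ 2 := Finset.sum_le_sum fun i hi => by
            have := abs_le.mp (hle i hi)
            exact sq_le_sq' (by linarith) (by linarith)
      _ = R.card * δ ^ 2 := by rw [Finset.sum_const, nsmul_eq_mul]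
  calc Real.sqrt (∑ i ∈ R, (h i x - h i x') ^ 2) ≤ Real.sqrt (R.card * δ ^ 2) := Real.sqrt_le_sqrt h1
    _ = Real.sqrt R.card * δ := by rw [Real.sqrt_mul (Nat.cast_nonneg _), Real.sqrt_sq hδ]

/-! ## §2  The refined family {h′_□}_{□∈𝒟′} on `Option ι` (`none` = □₀) -/

/-- **{h′_□}_{□∈𝒟′}**: `none` ↦ h′_{□₀} = `merged h R`; a kept cube `some i`, `i ∉ R`, ↦ h_i unchanged (*"𝒟′
coincides with 𝒟 outside □₀"*); a removed cube `some i`, `i ∈ R`, ↦ 0 (it is no longer a member of 𝒟′).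
[cite: Balaban1985BackgroundPropagators, p.411; model] -/
noncomputable def refine [DecidableEq ι] (h : ι → X → ℝ) (R : Finset ι) : Option ι → X → ℝ
  | none => merged h R
  | some i => if i ∈ R then 0 else h i

/-- h′_{□₀} = `merged h R`. [folklore] -/
@[simp] theorem refine_none [DecidableEq ι] (h : ι → X → ℝ) (R : Finset ι) : refine h R none = merged h R := rfl

/-- A removed cube carries the weight 0 in 𝒟′. [folklore] -/
theorem refine_some_of_mem [DecidableEq ι] (h : ι → X → ℝ) {R : Finset ι} {i : ι} (hi : i ∈ R) (x : X) :
    refine h R (some i) x = 0 := by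
  simp [refine, hi]

/-- A kept cube keeps its weight: h′_□ = h_□ (*"𝒟′ coincides with 𝒟 outside □₀"*). [folklore] -/
theorem refine_some_of_not_mem [DecidableEq ι] (h : ι → X → ℝ) {R : Finset ι} {i : ι} (hi : i ∉ R) :
    refine h R (some i) = h i := by
  simp [refine, hi]

/-- h′²_{□′} for □′ ∈ 𝒟 as a case split. [folklore] -/
theorem refine_some_sq [DecidableEq ι] (h : ι → X → ℝ) (R : Finset ι) (i : ι) (x : X) :
    refine h R (some i) x ^ 2 = if i ∈ R then 0 else h i x ^ 2 := by
  by_cases hi : i ∈ R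
  · rw [refine_some_of_mem h hi, if_pos hi]; ring
  · rw [refine_some_of_not_mem h hi, if_neg hi]

/-- **Σ_{□∈𝒟′} h′²_□ = Σ_{□∈𝒟} h²_□ pointwise** — refinement preserves the square sum. [folklore] -/
theorem sum_refine_sq [Fintype ι] [DecidableEq ι] (h : ι → X → ℝ) (R : Finset ι) (x : X) :
    ∑ o : Option ι, refine h R o x ^ 2 = ∑ i, h i x ^ 2 := by
  rw [Fintype.sum_option, refine_none, sum_sq_eq_merged_sq_add h R x]
  congr 1
  rw [← Finset.sum_add_sum_compl R (fun i => refine h R (some i) x ^ 2)]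
  have h0 : ∑ i ∈ R, refine h R (some i) x ^ 2 = 0 :=
    Finset.sum_eq_zero fun i hi => by rw [refine_some_sq, if_pos hi]
  rw [h0, zero_add]
  exact Finset.sum_congr rfl fun i hi => by
    rw [Finset.mem_compl] at hi
    rw [refine_some_sq, if_neg hi]

/-- **The partition-of-unity identity for 𝒟′**: Σ_{□∈𝒟′} h′²_□ = 1 from Σ_{□∈𝒟} h²_□ = 1 (the identity behind the
random walk expansion (3.90) *"for the partition 𝒟′"*, p. 411). [folklore] -/
theorem refine_pu [Fintype ι] [DecidableEq ι] (h : ι → X → ℝ) (R : Finset ι)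
    (hpu : ∀ x, ∑ i, h i x ^ 2 = 1) (x : X) : ∑ o : Option ι, refine h R o x ^ 2 = 1 := by
  rw [sum_refine_sq, hpu]

/-- |h′_□| ≤ 1 for every □ ∈ 𝒟′ under Σ_𝒟 h² = 1. [folklore] -/
theorem abs_refine_le_one [Fintype ι] [DecidableEq ι] (h : ι → X → ℝ) (R : Finset ι) {x : X}
    (hpu : ∑ i, h i x ^ 2 = 1) (o : Option ι) : |refine h R o x| ≤ 1 := by
  have hle : refine h R o x ^ 2 ≤ ∑ o' : Option ι, refine h R o' x ^ 2 :=
    Finset.single_le_sum (fun o' _ => sq_nonneg (refine h R o' x)) (Finset.mem_univ o)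
  rw [sum_refine_sq, hpu] at hle
  exact abs_le_one_iff_mul_self_le_one.mpr (by nlinarith)

/-- **Uniqueness of the model among non-negative refinements keeping the untouched h_□**: any family {g_□}_{□∈𝒟′}
with g_{□′} = h′_{□′} off □₀, g_{□₀}(x) ≥ 0 and the same total square sum has g_{□₀}(x) = h′_{□₀}(x). [folklore] -/
theorem refine_unique [Fintype ι] [DecidableEq ι] (h : ι → X → ℝ) (R : Finset ι) (g : Option ι → X → ℝ) (x : X)
    (hg : ∀ i, g (some i) x = refine h R (some i) x) (hg0 : 0 ≤ g none x)
    (hsum : ∑ o : Option ι, g o x ^ 2 = ∑ i, h i x ^ 2) : g none x = merged h R x := by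
  have href := sum_refine_sq h R x
  rw [Fintype.sum_option] at hsum href
  have hsome : ∑ i, g (some i) x ^ 2 = ∑ i, refine h R (some i) x ^ 2 :=
    Finset.sum_congr rfl fun i _ => by rw [hg]
  have hsq : g none x ^ 2 = merged h R x ^ 2 := by rw [refine_none] at href; linarith
  rw [← Real.sqrt_sq hg0, hsq, Real.sqrt_sq (merged_nonneg h R x)]

/-- **Iterating the refinement = merging over the union** (p. 415's 𝒟″ *"replacing □₀ by □̃₀² and removing from 𝒟′
all the cubes which intersect □̃₀"* in terms of the original cubes): merging, in the refined family, □₀ together with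
a further family R′ disjoint from R gives the merge of the ORIGINAL weights over R ∪ R′. [folklore] -/
theorem merged_refine [DecidableEq ι] (h : ι → X → ℝ) (R R' : Finset ι) (hdisj : Disjoint R R') (x : X) :
    merged (refine h R) (insert none (R'.map Function.Embedding.some)) x = merged h (R ∪ R') x := by
  unfold merged
  congr 1
  rw [Finset.sum_insert (by simp), Finset.sum_map, Finset.sum_union hdisj]
  have h1 : refine h R none x ^ 2 = ∑ i ∈ R, h i x ^ 2 := by rw [refine_none, merged_sq]
  rw [h1]
  congr 1
  exact Finset.sum_congr rfl fun i hi => by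
    have hiR : i ∉ R := fun hiR => Finset.disjoint_left.mp hdisj hiR hi
    rw [Function.Embedding.some_apply, refine_some_sq, if_neg hiR]

/-! ## §3  Abstract locality: the protected set and the removal rule (both cases of p. 411) -/

section Locality

variable (h : ι → X → ℝ) (cube : ι → Set X) (T : Set X) (R : Finset ι)

/-- **p. 412 *"Because of the restrictions introduced by the functions □̃, h_□, it is possible only if □′ = □₀"***:
if h_{□′} lives on `cube □′` (`hsupp`, the (1.118) support datum) and every cube meeting the protected set T was
removed (`hR`, p. 411 *"removing all the cubes intersecting □̃"*), then every weight that was NOT merged vanishes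
on T. [cite: Balaban1985BackgroundPropagators, p.412; derived] -/
theorem vanish_on_protected (hsupp : ∀ i x, h i x ≠ 0 → x ∈ cube i)
    (hR : ∀ i x, x ∈ T → x ∈ cube i → i ∈ R) {x : X} (hx : x ∈ T) {i : ι} (hi : i ∉ R) : h i x = 0 := by
  by_contra hne
  exact hi (hR i x hx (hsupp i x hne))

/-- The same for the refined family: on T every h′_{□′}, □′ ≠ □₀, vanishes. [cite: Balaban1985BackgroundPropagators, p.412; derived] -/
theorem refine_some_vanish [DecidableEq ι] (hsupp : ∀ i x, h i x ≠ 0 → x ∈ cube i)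
    (hR : ∀ i x, x ∈ T → x ∈ cube i → i ∈ R) {x : X} (hx : x ∈ T) (i : ι) : refine h R (some i) x = 0 := by
  by_cases hi : i ∈ R
  · exact refine_some_of_mem h hi x
  · rw [refine_some_of_not_mem h hi]
    exact vanish_on_protected h cube T R hsupp hR hx hi

/-- **p. 412 *"by the construction of the partition 𝒟′ we have h′_{□₀} = 1 on □̃"*** — derived: on the protected set
the merged weight is identically 1 (under Σ_𝒟 h² = 1). [cite: Balaban1985BackgroundPropagators, p.412; derived] -/
theorem merged_eq_one_on_protected [Fintype ι] (hsupp : ∀ i x, h i x ≠ 0 → x ∈ cube i)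
    (hR : ∀ i x, x ∈ T → x ∈ cube i → i ∈ R) (hpu : ∀ x, ∑ i, h i x ^ 2 = 1) {x : X} (hx : x ∈ T) :
    merged h R x = 1 :=
  merged_eq_one_of_vanish h R (hpu x) fun _ hi => vanish_on_protected h cube T R hsupp hR hx hi

/-- supp h′_{□₀} ⊂ ⋃_{□′∈R} cube □′ (= □₀ for 𝒟′): where the merged weight is non-zero some removed cube passes.
[folklore] -/
theorem exists_mem_cube_of_merged_ne_zero (hsupp : ∀ i x, h i x ≠ 0 → x ∈ cube i) {x : X}
    (hx : merged h R x ≠ 0) : ∃ i ∈ R, x ∈ cube i := by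
  obtain ⟨i, hi, hne⟩ := exists_ne_zero_of_merged_ne_zero h R hx
  exact ⟨i, hi, hsupp i x hne⟩

end Locality

/-! ## §4  Coordinates: the cubes c + Mk of 𝒟_j (case 1 of p. 411; 𝒟″ of p. 415) -/

section Coordinates

variable {d : ℕ}

/-- **The arithmetic of "intersecting □̃ⁿ⁻¹"**: a point with |t| ≤ nM lying in the OPEN cube of half-width M about
Mk forces |k| ≤ n (M > 0). [folklore] -/
theorem int_abs_le_of_lt {M : ℝ} (hM : 0 < M) (n : ℕ) (t : ℝ) (k : ℤ) (ht : |t| ≤ n * M)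
    (hk : |t - M * k| < M) : |k| ≤ n := by
  have ht' := abs_le.mp ht
  have hk' := abs_lt.mp hk
  have h1 : M * (k : ℝ) < M * ((n : ℝ) + 1) := by linarith
  have h2 : M * (-((n : ℝ) + 1)) < M * (k : ℝ) := by linarith
  have hk1 : (k : ℝ) < (n : ℝ) + 1 := lt_of_mul_lt_mul_left h1 hM.le
  have hk2 : -((n : ℝ) + 1) < (k : ℝ) := lt_of_mul_lt_mul_left h2 hM.le
  have hz1 : k < (n : ℤ) + 1 := by exact_mod_cast hk1
  have hz2 : -((n : ℤ) + 1) < k := by exact_mod_cast hk2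
  exact abs_le.mpr ⟨by omega, by omega⟩

/-- The support datum of (1.118) in B9's Sect. C coordinates: the weight of the cube of 𝒟_j labelled `i`, centred
at c + M·(lab i), vanishes off the open cube of half-width M about its centre (print: off the (2/3)M-cube).
[cite: Balaban1984PropagatorsI, (1.118) p.36 (supp h_z); hypothesis shape] -/
def SupportedInCubes (c : Fin d → ℝ) (M : ℝ) (lab : ι → Fin d → ℤ) (h : ι → (Fin d → ℝ) → ℝ) : Prop :=
  ∀ i x, h i x ≠ 0 → ∀ j, |x j - c j - M * (lab i j : ℝ)| < M

/-- **Every kept weight vanishes on {|x − c|_∞ ≤ nM}** once all cubes with |k|_∞ ≤ n were removed (case 1 of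
p. 411 with n = 2; 𝒟″ with n = 4). [cite: Balaban1985BackgroundPropagators, p.412; derived] -/
theorem vanish_on_box (c : Fin d → ℝ) {M : ℝ} (hM : 0 < M) (lab : ι → Fin d → ℤ) (h : ι → (Fin d → ℝ) → ℝ)
    (hsupp : SupportedInCubes c M lab h) (n : ℕ) (R : Finset ι)
    (hR : ∀ i, (∀ j, |lab i j| ≤ n) → i ∈ R) {x : Fin d → ℝ} (hx : ∀ j, |x j - c j| ≤ n * M)
    {i : ι} (hi : i ∉ R) : h i x = 0 := by
  by_contra hne
  exact hi (hR i fun j => int_abs_le_of_lt hM n (x j - c j) (lab i j) (hx j) (hsupp i x hne j))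

/-- **h′ = 1 on {|x − c|_∞ ≤ nM}** for any removed family R ⊇ {|k|_∞ ≤ n}, under Σ_𝒟 h² = 1.
[cite: Balaban1985BackgroundPropagators, p.412; derived] -/
theorem merged_eq_one_on_box [Fintype ι] (c : Fin d → ℝ) {M : ℝ} (hM : 0 < M) (lab : ι → Fin d → ℤ) (h : ι → (Fin d → ℝ) → ℝ)
    (hsupp : SupportedInCubes c M lab h)
    (hpu : ∀ x, ∑ i, h i x ^ 2 = 1) (n : ℕ) (R : Finset ι) (hR : ∀ i, (∀ j, |lab i j| ≤ n) → i ∈ R)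
    {x : Fin d → ℝ} (hx : ∀ j, |x j - c j| ≤ n * M) : merged h R x = 1 :=
  merged_eq_one_of_vanish h R (hpu x) fun _ hi => vanish_on_box c hM lab h hsupp n R hR hx hi

/-- **supp h′ inside {|x − c|_∞ < (n+1)M}** when R = {|k|_∞ ≤ n} exactly (the interior of □̃ⁿ — for n = 2 the new
cube □₀ = □̃², for n = 4 the cube □̃₀² = □̃⁴). [folklore] -/
theorem merged_support_box (c : Fin d → ℝ) {M : ℝ} (hM : 0 < M) (lab : ι → Fin d → ℤ) (h : ι → (Fin d → ℝ) → ℝ)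
    (hsupp : SupportedInCubes c M lab h) (n : ℕ) (R : Finset ι)
    (hR' : ∀ i ∈ R, ∀ j, |lab i j| ≤ n) {x : Fin d → ℝ} (hx : merged h R x ≠ 0) :
    ∀ j, |x j - c j| < (n + 1) * M := by
  obtain ⟨i, hi, hne⟩ := exists_ne_zero_of_merged_ne_zero h R hx
  intro j
  have h1 := abs_lt.mp (hsupp i x hne j)
  have h2 : |(lab i j : ℝ)| ≤ n := by exact_mod_cast hR' i hi j
  have h3 := abs_le.mp h2
  have h4 : M * (lab i j : ℝ) ≤ M * n := mul_le_mul_of_nonneg_left h3.2 hM.le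
  have h5 : M * (-(n : ℝ)) ≤ M * (lab i j : ℝ) := mul_le_mul_of_nonneg_left h3.1 hM.le
  exact abs_lt.mpr ⟨by linarith, by linarith⟩

/-- **𝒟′, case 1 of p. 411 (n = 2)**: removing (at least) the 5^d cubes c + Mk, |k|_∞ ≤ 2 (`B9SectCCubes.shifts`),
h′_{□₀} = 1 on □̃ = {|x − c|_∞ ≤ 2M} (= `B9SectCCubes.tilde c M 1`).
[cite: Balaban1985BackgroundPropagators, p.412 «h′_{□₀} = 1 on □̃»; derived] -/
theorem p412_hprime_eq_one [Fintype ι] (c : Fin d → ℝ) {M : ℝ} (hM : 0 < M) (lab : ι → Fin d → ℤ) (h : ι → (Fin d → ℝ) → ℝ)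
    (hsupp : SupportedInCubes c M lab h)
    (hpu : ∀ x, ∑ i, h i x ^ 2 = 1) (R : Finset ι) (hR : ∀ i, (∀ j, |lab i j| ≤ 2) → i ∈ R)
    {x : Fin d → ℝ} (hx : ∀ j, |x j - c j| ≤ 2 * M) : merged h R x = 1 :=
  merged_eq_one_on_box c hM lab h hsupp hpu 2 R hR (by simpa using hx)

/-- **𝒟′, case 1 (n = 2)**: every kept h′_{□′} = h_{□′}, □′ ≠ □₀, vanishes on □̃ — p. 412 *"it is possible only
if □′ = □₀"*. [cite: Balaban1985BackgroundPropagators, p.412; derived] -/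
theorem p412_kept_vanish (c : Fin d → ℝ) {M : ℝ} (hM : 0 < M) (lab : ι → Fin d → ℤ) (h : ι → (Fin d → ℝ) → ℝ)
    (hsupp : SupportedInCubes c M lab h) (R : Finset ι)
    (hR : ∀ i, (∀ j, |lab i j| ≤ 2) → i ∈ R) {x : Fin d → ℝ} (hx : ∀ j, |x j - c j| ≤ 2 * M)
    {i : ι} (hi : i ∉ R) : h i x = 0 :=
  vanish_on_box c hM lab h hsupp 2 R hR (by simpa using hx) hi

/-- **𝒟′, case 1 (n = 2)**: with exactly the 5^d cubes removed, h′_{□₀} is supported in the interior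
{|x − c|_∞ < 3M} of □₀ = □̃² (`B9SectCCubes.box0_eq`). [folklore] -/
theorem p411_hprime_support (c : Fin d → ℝ) {M : ℝ} (hM : 0 < M) (lab : ι → Fin d → ℤ) (h : ι → (Fin d → ℝ) → ℝ)
    (hsupp : SupportedInCubes c M lab h) (R : Finset ι)
    (hR' : ∀ i ∈ R, ∀ j, |lab i j| ≤ 2) {x : Fin d → ℝ} (hx : merged h R x ≠ 0) :
    ∀ j, |x j - c j| < 3 * M := by
  have := merged_support_box c hM lab h hsupp 2 R hR' hx
  norm_num at this
  exact this

/-- **𝒟″ of p. 415 (n = 4)**: removing the 9^d cubes c + Mk, |k|_∞ ≤ 4 (= □₀'s 5^d together with the cubes of 𝒟′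
meeting □̃₀ = □̃³, cf. `merged_refine`), the new weight is 1 on □̃₀ = □̃³ = {|x − c|_∞ ≤ 4M}.
[cite: Balaban1985BackgroundPropagators, p.415; derived] -/
theorem p415_hsecond_eq_one [Fintype ι] (c : Fin d → ℝ) {M : ℝ} (hM : 0 < M) (lab : ι → Fin d → ℤ) (h : ι → (Fin d → ℝ) → ℝ)
    (hsupp : SupportedInCubes c M lab h)
    (hpu : ∀ x, ∑ i, h i x ^ 2 = 1) (R : Finset ι) (hR : ∀ i, (∀ j, |lab i j| ≤ 4) → i ∈ R)
    {x : Fin d → ℝ} (hx : ∀ j, |x j - c j| ≤ 4 * M) : merged h R x = 1 :=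
  merged_eq_one_on_box c hM lab h hsupp hpu 4 R hR (by simpa using hx)

/-- **𝒟″ (n = 4)**: the new weight is supported in the interior {|x − c|_∞ < 5M} of □̃₀² = □̃⁴
(`B9SectCCubes.p415_tilde0_two`). [folklore] -/
theorem p415_hsecond_support (c : Fin d → ℝ) {M : ℝ} (hM : 0 < M) (lab : ι → Fin d → ℤ) (h : ι → (Fin d → ℝ) → ℝ)
    (hsupp : SupportedInCubes c M lab h) (R : Finset ι)
    (hR' : ∀ i ∈ R, ∀ j, |lab i j| ≤ 4) {x : Fin d → ℝ} (hx : merged h R x ≠ 0) :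
    ∀ j, |x j - c j| < 5 * M := by
  have := merged_support_box c hM lab h hsupp 4 R hR' hx
  norm_num at this
  exact this

end Coordinates

/-! ## §6  The (1.118) product class: the merge factorises -/

/-- √(Π_i f_i) = Π_i √(f_i) for non-negative factors. [folklore] -/
theorem sqrt_prod_eq {κ : Type*} [DecidableEq κ] (s : Finset κ) (f : κ → ℝ) (hf : ∀ i ∈ s, 0 ≤ f i) :
    Real.sqrt (∏ i ∈ s, f i) = ∏ i ∈ s, Real.sqrt (f i) := by
  induction s using Finset.induction_on with
  | empty => simp
  | @insert a s ha ih =>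
    rw [Finset.prod_insert ha, Finset.prod_insert ha, Real.sqrt_mul (hf a (Finset.mem_insert_self a s)),
      ih fun i hi => hf i (Finset.mem_insert_of_mem hi)]

/-- **The merge of PRODUCT weights over a PRODUCT family factorises** (the (1.118) class h_z(x) = Π_μ h((x_μ − z_μ)/M₀),
removed family = {|k|_∞ ≤ n} = a product of 1-D windows): h′_{□₀}(x) = Π_μ √(Σ_{n∈S} g_μ(n, x)²) — the d-dimensional
merged weight is the product of the one-dimensional merged profiles. [folklore] -/
theorem merged_pi {d : ℕ} (S : Finset ℤ) (g : Fin d → ℤ → X → ℝ) (x : X) :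
    merged (fun (k : Fin d → ℤ) y => ∏ μ, g μ (k μ) y) (Fintype.piFinset fun _ => S) x
      = ∏ μ, merged (g μ) S x := by
  unfold merged
  have h1 : ∑ k ∈ Fintype.piFinset (fun _ : Fin d => S), (∏ μ, g μ (k μ) x) ^ 2
      = ∏ μ, ∑ n ∈ S, g μ n x ^ 2 := by
    rw [Finset.prod_univ_sum]
    exact Finset.sum_congr rfl fun k _ => (Finset.prod_pow _ 2 _).symm
  rw [h1, sqrt_prod_eq _ _ fun μ _ => Finset.sum_nonneg fun n _ => sq_nonneg _]

/-- **Where exactly one merged weight is alive, the merge is its absolute value** (the transition zone of the 1-D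
(1.118) profiles: between the outermost removed centre and the first kept one only these two profiles are alive, so
there the 1-D merged profile IS h(· − 2M₀) for h ≥ 0 — as smooth as h). [folklore] -/
theorem merged_eq_abs_of_single (h : ι → X → ℝ) (R : Finset ι) {n : ι} (hn : n ∈ R) {x : X}
    (hvan : ∀ i ∈ R, i ≠ n → h i x = 0) : merged h R x = |h n x| := by
  unfold merged
  rw [Finset.sum_eq_single_of_mem n hn fun i hi hne => by rw [hvan i hi hne]; ring, Real.sqrt_sq_eq_abs]

/-! ## §5  Sanity instances -/

/-- One dimension, two cubes with weights (3/5, 4/5) at a point: merging both gives weight 1. -/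
example : merged (fun (i : Fin 2) (_ : Unit) => if i = 0 then (3 : ℝ) / 5 else 4 / 5) Finset.univ () = 1 := by
  rw [merged_eq_one_iff]
  simp [Fin.sum_univ_two]
  norm_num

end Literature.MathematicalPhysics.QuantumFieldTheory.Balaban1983to89.B9SectCRefine
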